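import Literature.NumberTheory.Transcendental.ZudilinSaddleNumerics
import HarnessLib

/-!
# Kernel certificates for the saddle point of Zudilin's phase

Topic `Literature/NumberTheory/Transcendental`; evaluates, inside the Lean kernel
(`decide +kernel`, no compiler axiom), the interval evaluators of `ZudilinSaddleNumerics.lean`
(`Literature.NumberTheory.Transcendental.Zudilin2004.SaddleNum.phaseBox` etc.) and turns the
accepted checks into real-number statements about `Φ = Zudilin2004.phase`, `Φ'`, `Φ''` and the
saddle polynomial `Q = Zudilin2004.saddleQ` near `κ̃ = Zudilin2004.SaddleNum.kApprox`
(`≈ 23.4790054183 + 3.3282069055 i`; [Zudilin2004, §8 proof of Thm. 3] prints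
`τ₀ = 91 − κ̄₀ ≈ 87.47900541 + 3.32820690 i` and `C₀ = −Re Φ(κ₀) = 227.58019641`):

* `normSq_saddleQ_shift_gt` — `2^32 |Q(κ̃)|² < |Q(κ̃ + 2^{−60})|²` (so `Q` has a root within
  `2^{−60}` of `κ̃`, see `ZudilinSaddle.lean`);
* `norm_dphase_lt_one_of_mem_boxB` — `‖Φ'(κ)‖ < 1` on `boxB = κ̃ + [−2^{−60}, 2^{−60}]²`;
* `re_ddphase_ge_of_mem_saddleBox` — `re Φ''(κ) ≥ 3/5` on `saddleBox`;
* `re_ddphase_ge_near` — `re Φ''(κ) ≥ 3/5` for `|re κ − re κ̃| ≤ 2^{−60}`, `|im κ − im κ̃| ≤ 1/4 + 2^{−60}`;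
* `re_ddphase_pos_line` — `re Φ''(x + iu) > 0` for `|x − re κ̃| ≤ 2^{−60}`, `0 ≤ u ≤ 32`
  (a scan of `64` boxes of height `½`);
* `re_phase_le_of_mem_boxB` — `Re Φ(κ) ≤ −227.58` on `boxB`;
* `im_phase_bounds_of_mem_boxB` — `58π + 1/5 < Im Φ(κ) < 58π + 1/2` on `boxB`;
* `re_phase_tenth_add_four_le` — `Re Φ(x + i/10) + 4 ≤ Re Φ(κ)` for `κ ∈ boxB`,
  `|x − re κ̃| ≤ 2^{−60}`.

Everything here is PROVED; no definitions, no named facts. (Kernel time: about 50 s in all.)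

## References

* [Zudilin2004] W. Zudilin, J. Théor. Nombres Bordeaux 16 (2004), §8, Lemma 20, proof of Thm. 3.
-/

noncomputable section

open Complex
open Literature.Analysis.ValidatedNumerics.NumericsMP

namespace Literature.NumberTheory.Transcendental

namespace Zudilin2004

namespace SaddleNum

/-! ### The kernel evaluations -/

/-- (C1) `2^32 · hi |Q(κ̃)|² < lo |Q(κ̃ + 2^{−60})|²` at scale `2^150`. [folklore] -/
theorem cert_saddleQ :
    decide (2 ^ 32 * ((saddleQBox (2 ^ 150) ⟨⟨pRe * 2 ^ 50, pRe * 2 ^ 50⟩, ⟨pIm * 2 ^ 50, pIm * 2 ^ 50⟩⟩).normSq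
        (2 ^ 150)).hi < ((saddleQBox (2 ^ 150) ⟨⟨pRe * 2 ^ 50 + 2 ^ 90, pRe * 2 ^ 50 + 2 ^ 90⟩,
          ⟨pIm * 2 ^ 50, pIm * 2 ^ 50⟩⟩).normSq (2 ^ 150)).lo) = true := by
  decide +kernel

/-- (C2) `‖Φ'‖ · 2^100 < 2^100` on `boxB` (indeed `≈ 3·10⁻¹⁸`). [folklore] -/
theorem cert_dphase :
    (match piBox with
      | some P =>
        match dphaseBox P boxB with
        | some D => decide (D.re.absHi + D.im.absHi < 2 ^ 100)
        | none => false
      | none => false) = true := by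
  decide +kernel

/-- (C3) `re Φ'' ≥ 3/5` on `sBox ⊇ saddleBox` and on `lineBox (im κ̃ ± (1/4 + 2^{−60}))`.
[folklore] -/
theorem cert_ddphase :
    (match ddphaseBox sBox, ddphaseBox (lineBox (pIm - 2 ^ 40 - 2 ^ 98) (pIm + 2 ^ 40 + 2 ^ 98)) with
      | some D, some E => decide (3 * (S : ℤ) ≤ 5 * D.re.lo ∧ 3 * (S : ℤ) ≤ 5 * E.re.lo)
      | _, _ => false) = true := by
  decide +kernel

/-- (C4) the scan `re Φ'' > 0` for `u ∈ [0, 32]` in `64` steps of `½`. [folklore] -/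
theorem cert_concave : checkConcave 99 0 64 = true := by
  decide +kernel

/-- (C5)–(C7) the values of `Φ` on `boxB` and at height `1/10`:
`Re Φ ≤ −227.58`, `58π + 1/5 < Im Φ < 58π + 1/2`, `Re Φ(· + i/10) + 4 ≤ Re Φ(boxB)`. [folklore] -/
theorem cert_phase :
    (match piBox with
      | some P =>
        match phaseBox P boxB, phaseBox P (lineBox (MI.ofFrac S 1 10).lo (MI.ofFrac S 1 10).hi) with
        | some F, some G =>
          decide (100 * F.re.hi ≤ -22758 * (S : ℤ) ∧ 5 * (58 * P.hi) + (S : ℤ) < 5 * F.im.lo ∧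
            2 * F.im.hi < 2 * (58 * P.lo) + (S : ℤ) ∧ G.re.hi + 4 * (S : ℤ) ≤ F.re.lo)
        | _, _ => false
      | none => false) = true := by
  decide +kernel

/-! ### Real-number consequences -/

/-- [folklore] -/
theorem S_realPos : (0 : ℝ) < S := by rw [S_eq]; norm_num

/-- **`2^32 |Q(κ̃)|² < |Q(κ̃ + 2^{−60})|²`.** [cite: Zudilin2004, §8 proof of Thm. 3] -/
theorem normSq_saddleQ_shift_gt :
    2 ^ 32 * Complex.normSq (saddleQ kApprox) <
      Complex.normSq (saddleQ (kApprox + ((2 : ℝ) ^ (-60 : ℤ) : ℝ))) := by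
  have hT : 0 < 2 ^ 150 := by positivity
  have eT : (((2 ^ 150 : ℕ) : ℕ) : ℝ) = (2 : ℝ) ^ 150 := by norm_cast
  have e60 : (2 : ℝ) ^ (-60 : ℤ) * 2 ^ 150 = 2 ^ 90 := by
    rw [← zpow_natCast, ← zpow_add₀ (by norm_num)]; norm_num
  have hk_re : kApprox.re * (2 : ℝ) ^ 150 = (pRe : ℝ) * 2 ^ 50 := by
    rw [kApprox_re]; field_simp
  have hk_im : kApprox.im * (2 : ℝ) ^ 150 = (pIm : ℝ) * 2 ^ 50 := by
    rw [kApprox_im]; field_simp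
  have hw_re : (kApprox + ((2 : ℝ) ^ (-60 : ℤ) : ℝ)).re * (2 : ℝ) ^ 150 = (pRe : ℝ) * 2 ^ 50 + 2 ^ 90 := by
    rw [add_re, ofReal_re, add_mul, hk_re, e60]
  have hw_im : (kApprox + ((2 : ℝ) ^ (-60 : ℤ) : ℝ)).im * (2 : ℝ) ^ 150 = (pIm : ℝ) * 2 ^ 50 := by
    rw [add_im, ofReal_im, add_zero, hk_im]
  have c1 : ((pRe * 2 ^ 50 : ℤ) : ℝ) = (pRe : ℝ) * 2 ^ 50 := by norm_cast
  have c2 : ((pIm * 2 ^ 50 : ℤ) : ℝ) = (pIm : ℝ) * 2 ^ 50 := by norm_cast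
  have c3 : ((pRe * 2 ^ 50 + 2 ^ 90 : ℤ) : ℝ) = (pRe : ℝ) * 2 ^ 50 + 2 ^ 90 := by norm_cast
  have hk : MC.mem (2 ^ 150) kApprox ⟨⟨pRe * 2 ^ 50, pRe * 2 ^ 50⟩, ⟨pIm * 2 ^ 50, pIm * 2 ^ 50⟩⟩ := by
    refine ⟨⟨?_, ?_⟩, ⟨?_, ?_⟩⟩ <;> simp only [eT, hk_re, hk_im, c1, c2] <;> exact le_rfl
  have hw : MC.mem (2 ^ 150) (kApprox + ((2 : ℝ) ^ (-60 : ℤ) : ℝ))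
      ⟨⟨pRe * 2 ^ 50 + 2 ^ 90, pRe * 2 ^ 50 + 2 ^ 90⟩, ⟨pIm * 2 ^ 50, pIm * 2 ^ 50⟩⟩ := by
    refine ⟨⟨?_, ?_⟩, ⟨?_, ?_⟩⟩ <;> simp only [eT, hw_re, hw_im, c2, c3] <;> exact le_rfl
  have h1 := (MC.mem_normSq hT (mem_saddleQBox hT hk)).2
  have h2 := (MC.mem_normSq hT (mem_saddleQBox hT hw)).1
  rw [eT] at h1 h2
  have hc := of_decide_eq_true cert_saddleQ
  have hc' : (2 : ℝ) ^ 32 * (((saddleQBox (2 ^ 150) ⟨⟨pRe * 2 ^ 50, pRe * 2 ^ 50⟩,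
      ⟨pIm * 2 ^ 50, pIm * 2 ^ 50⟩⟩).normSq (2 ^ 150)).hi : ℝ) <
      (((saddleQBox (2 ^ 150) ⟨⟨pRe * 2 ^ 50 + 2 ^ 90, pRe * 2 ^ 50 + 2 ^ 90⟩,
        ⟨pIm * 2 ^ 50, pIm * 2 ^ 50⟩⟩).normSq (2 ^ 150)).lo : ℝ) := by exact_mod_cast hc
  have hpos : (0 : ℝ) < 2 ^ 150 := by positivity
  refine lt_of_mul_lt_mul_right ?_ hpos.le
  calc 2 ^ 32 * Complex.normSq (saddleQ kApprox) * 2 ^ 150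
      = 2 ^ 32 * (Complex.normSq (saddleQ kApprox) * 2 ^ 150) := by ring
    _ ≤ _ := mul_le_mul_of_nonneg_left h1 (by positivity)
    _ < _ := hc'
    _ ≤ _ := h2

/-- `piBox = some P` with `π ∈ P`. [folklore] -/
theorem piBox_spec : ∃ P, piBox = some P ∧ MI.mem S Real.pi P := by
  cases hP : piBox with
  | none => have h := cert_dphase; simp [hP] at h
  | some P => exact ⟨P, rfl, MI.mem_pi S (by rw [← hP]; rfl)⟩

/-- **`‖Φ'(κ)‖ < 1` on `boxB`.** [cite: Zudilin2004, §8 proof of Thm. 3] -/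
theorem norm_dphase_lt_one_of_mem_boxB {κ : ℂ} (hκ : MC.mem S κ boxB) : ‖dphase κ‖ < 1 := by
  obtain ⟨P, hP, hpi⟩ := piBox_spec
  have h := cert_dphase
  simp only [hP] at h
  cases hD : dphaseBox P boxB with
  | none => rw [hD] at h; exact absurd h Bool.false_ne_true
  | some D =>
    rw [hD] at h
    simp only [decide_eq_true_eq] at h
    have hm := mem_dphaseBox hpi hκ hD
    have hre := MI.abs_le_absHi hm.1
    have him := MI.abs_le_absHi hm.2
    have hS := S_realPos
    have hlt : ((D.re.absHi + D.im.absHi : ℤ) : ℝ) < (2 : ℝ) ^ 100 := by exact_mod_cast h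
    have hsum : (|(dphase κ).re| + |(dphase κ).im|) * S < 2 ^ 100 := by
      push_cast at hlt; nlinarith
    rw [S_eq] at hsum
    have := norm_le_abs_re_add_abs_im (dphase κ)
    nlinarith

/-- **`re Φ''(κ) ≥ 3/5` on `saddleBox`.** [cite: Zudilin2004, §8 proof of Thm. 3] -/
theorem re_ddphase_ge_of_mem_saddleBox {κ : ℂ} (hκ : κ ∈ saddleBox) : 3 / 5 ≤ (ddphase κ).re := by
  have h := cert_ddphase
  cases hD : ddphaseBox sBox with
  | none => rw [hD] at h; exact absurd h Bool.false_ne_true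
  | some D =>
    cases hE : ddphaseBox (lineBox (pIm - 2 ^ 40 - 2 ^ 98) (pIm + 2 ^ 40 + 2 ^ 98)) with
    | none => rw [hD, hE] at h; exact absurd h Bool.false_ne_true
    | some E =>
      rw [hD, hE] at h
      simp only [decide_eq_true_eq] at h
      have hm := (mem_ddphaseBox (mem_sBox hκ) hD).1
      have h1 : (3 : ℝ) * S ≤ 5 * D.re.lo := by exact_mod_cast h.1
      have hS := S_realPos
      nlinarith [hm.1]

/-- **`re Φ''(κ) ≥ 3/5` near `κ̃`:** for `|re κ − re κ̃| ≤ 2^{−60}` and `|im κ − im κ̃| ≤ 1/4 + 2^{−60}`.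
[cite: Zudilin2004, §8 proof of Thm. 3] -/
theorem re_ddphase_ge_near {κ : ℂ} (hre : |κ.re - kApprox.re| ≤ (2 : ℝ) ^ (-60 : ℤ))
    (him : |κ.im - kApprox.im| ≤ 1 / 4 + (2 : ℝ) ^ (-60 : ℤ)) : 3 / 5 ≤ (ddphase κ).re := by
  have h := cert_ddphase
  cases hD : ddphaseBox sBox with
  | none => rw [hD] at h; exact absurd h Bool.false_ne_true
  | some D =>
    cases hE : ddphaseBox (lineBox (pIm - 2 ^ 40 - 2 ^ 98) (pIm + 2 ^ 40 + 2 ^ 98)) with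
    | none => rw [hD, hE] at h; exact absurd h Bool.false_ne_true
    | some E =>
      rw [hD, hE] at h
      simp only [decide_eq_true_eq] at h
      have e60 : (2 : ℝ) ^ (-60 : ℤ) * 2 ^ 100 = 2 ^ 40 := by
        rw [← zpow_natCast, ← zpow_add₀ (by norm_num)]; norm_num
      rw [kApprox_im, abs_le] at him
      have hmem : MC.mem S κ (lineBox (pIm - 2 ^ 40 - 2 ^ 98) (pIm + 2 ^ 40 + 2 ^ 98)) := by
        refine mem_lineBox hre ?_ ?_ <;> push_cast <;> nlinarith [e60]
      have hm := (mem_ddphaseBox hmem hE).1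
      have h1 : (3 : ℝ) * S ≤ 5 * E.re.lo := by exact_mod_cast h.2
      have hS := S_realPos
      nlinarith [hm.1]

/-- **`re Φ''(x + iu) > 0` up the line**: for `|x − re κ̃| ≤ 2^{−60}` and `0 ≤ u ≤ 32` (beyond,
`im Φ' > 0` by an elementary bound, see `ZudilinSaddle.lean`). [cite: Zudilin2004, §8 Lemma 20] -/
theorem re_ddphase_pos_line {κ : ℂ} (hre : |κ.re - kApprox.re| ≤ (2 : ℝ) ^ (-60 : ℤ))
    (h0 : 0 ≤ κ.im) (h1 : κ.im ≤ 32) : 0 < (ddphase κ).re := by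
  refine re_ddphase_pos_of_checkConcave cert_concave (by norm_num) hre ?_ ?_
  · push_cast; nlinarith
  · push_cast
    have : (2 : ℝ) ^ 100 = 2 * 2 ^ 99 := by norm_num
    rw [this]; nlinarith

/-- **`Re Φ(κ) ≤ −227.58` on `boxB`** (`C₀ = 227.58019641…` in the source).
[cite: Zudilin2004, §8 proof of Thm. 3] -/
theorem re_phase_le_of_mem_boxB {κ : ℂ} (hκ : MC.mem S κ boxB) : (phase κ).re ≤ -(22758 / 100) := by
  obtain ⟨P, hP, hpi⟩ := piBox_spec
  have h := cert_phase
  simp only [hP] at h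
  cases hF : phaseBox P boxB with
  | none => rw [hF] at h; exact absurd h Bool.false_ne_true
  | some F =>
    cases hG : phaseBox P (lineBox (MI.ofFrac S 1 10).lo (MI.ofFrac S 1 10).hi) with
    | none => rw [hF, hG] at h; exact absurd h Bool.false_ne_true
    | some G =>
      rw [hF, hG] at h
      simp only [decide_eq_true_eq] at h
      have hm := (mem_phaseBox hpi hκ hF).1
      have h1 : (100 : ℝ) * F.re.hi ≤ -22758 * S := by exact_mod_cast h.1
      have hS := S_realPos
      nlinarith [hm.2]

/-- **`58π + 1/5 < Im Φ(κ) < 58π + 1/2` on `boxB`** (so `sin (Im Φ(κ₀)) ≠ 0`).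
[cite: Zudilin2004, §8 proof of Thm. 3] -/
theorem im_phase_bounds_of_mem_boxB {κ : ℂ} (hκ : MC.mem S κ boxB) :
    58 * Real.pi + 1 / 5 < (phase κ).im ∧ (phase κ).im < 58 * Real.pi + 1 / 2 := by
  obtain ⟨P, hP, hpi⟩ := piBox_spec
  have h := cert_phase
  simp only [hP] at h
  cases hF : phaseBox P boxB with
  | none => rw [hF] at h; exact absurd h Bool.false_ne_true
  | some F =>
    cases hG : phaseBox P (lineBox (MI.ofFrac S 1 10).lo (MI.ofFrac S 1 10).hi) with
    | none => rw [hF, hG] at h; exact absurd h Bool.false_ne_true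
    | some G =>
      rw [hF, hG] at h
      simp only [decide_eq_true_eq] at h
      have hm := (mem_phaseBox hpi hκ hF).2
      have h2 : (5 : ℝ) * (58 * P.hi) + S < 5 * F.im.lo := by exact_mod_cast h.2.1
      have h3 : (2 : ℝ) * F.im.hi < 2 * (58 * P.lo) + S := by exact_mod_cast h.2.2.1
      have hS := S_realPos
      constructor <;> nlinarith [hm.1, hm.2, hpi.1, hpi.2]

/-- **`Re Φ(x + i/10) + 4 ≤ Re Φ(κ)`** for `κ ∈ boxB` and `|x − re κ̃| ≤ 2^{−60}` (the line at
height `1/10` is far below the saddle value). [cite: Zudilin2004, §8 Lemma 20] -/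
theorem re_phase_tenth_add_four_le {κ κ' : ℂ} (hκ : MC.mem S κ boxB)
    (hre : |κ'.re - kApprox.re| ≤ (2 : ℝ) ^ (-60 : ℤ)) (him : κ'.im = 1 / 10) :
    (phase κ').re + 4 ≤ (phase κ).re := by
  obtain ⟨P, hP, hpi⟩ := piBox_spec
  have h := cert_phase
  simp only [hP] at h
  cases hF : phaseBox P boxB with
  | none => rw [hF] at h; exact absurd h Bool.false_ne_true
  | some F =>
    cases hG : phaseBox P (lineBox (MI.ofFrac S 1 10).lo (MI.ofFrac S 1 10).hi) with
    | none => rw [hF, hG] at h; exact absurd h Bool.false_ne_true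
    | some G =>
      rw [hF, hG] at h
      simp only [decide_eq_true_eq] at h
      have hfrac := MI.mem_ofFrac S 1 (q := 10) (by norm_num)
      have hmem : MC.mem S κ' (lineBox (MI.ofFrac S 1 10).lo (MI.ofFrac S 1 10).hi) := by
        refine mem_lineBox hre ?_ ?_
        · have := hfrac.1; rw [him, ← S_eq]; push_cast at this; simpa using this
        · have := hfrac.2; rw [him, ← S_eq]; push_cast at this; simpa using this
      have hm := (mem_phaseBox hpi hκ hF).1
      have hm' := (mem_phaseBox hpi hmem hG).1
      have h4 : (G.re.hi : ℝ) + 4 * S ≤ F.re.lo := by exact_mod_cast h.2.2.2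
      have hS := S_realPos
      nlinarith [hm.1, hm'.2]

end SaddleNum

end Zudilin2004

end Literature.NumberTheory.Transcendental
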